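import Summits.HodgeConjecture.HodgeConjecture.Theorems.VHCAbelianSchemesRoadNowhereDisplaceableDefs
import Summits.HodgeConjecture.HodgeConjecture.Theorems.VHCAbelianSchemesRoadProperJumpOfConfinedLifts
import Summits.HodgeConjecture.HodgeConjecture.Theorems.VHCAbelianSchemesRoadNowhereDisplaceableOfLine
import Summits.HodgeConjecture.HodgeConjecture.Theorems.VHCAbelianSchemesRoadExtJumpLocusLiftsOfRetract
import Summits.HodgeConjecture.HodgeConjecture.Theorems.VHCAbelianSchemesRoadPreimageProperClosedOfIsogeny
import Summits.HodgeConjecture.HodgeConjecture.Theorems.VHCAbelianSchemesRoadMoverConfinementOfKSimpleHolds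
import Summits.HodgeConjecture.HodgeConjecture.Theorems.VHCAbelianSchemesRoadKSimpleOfEndTrivial
import HarnessLib

/-!
# Road №4 (`VHCAbelianSchemesRoad`), crux stmt-HodgeConjecture-26512 `DiagLocalOfMarkmanPinnedForall` — THE LIFTED CARRIER (N-U⁺), Theorems-lane cut
# (hypothesis form, SORRY-FREE; §1–§2 of `Cruxes/DiagLocalOfMarkmanPinnedForall/LiftedCarrier.lean` c5bef5262253 BYTE-FOR-BYTE, §3 crux-by-name omitted)

research route conditional on HC_CM; not a corollary. Prepared by `plan-lens-HodgeAV-26512-transfer` g4 for director-hodge g17's FILE 6 (R17.68, TRIGGER B):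
the declarations below are the §1 statements and §2 theorems of the Cruxes file VERBATIM, re-homed to the Theorems lane (imports: Theorems ∕ Literature ∕
HarnessLib only; namespace `…Ring2.SemiregularRepresentatives.NowhereDisplaceable`, the home of p672648 ∕ p673373 ∕ p674094 ∕ p674291 ∕ p674495).
HYPOTHESIS FORM: (N-U) `UpstairsProperJumpCarrierEnd`, (N-F) `ExtJumpLocusLifts`, (N-U⁺) `UpstairsProperJumpLiftedCarrierEnd`, (S4) `ProperJumpCarrierEnd`,
(R) `PushPullRetract`, (N-U_R) `UpstairsProperJumpRetractCarrierEnd`, (N-U⁺ᶠ) `FactorConfinedLiftedCarrierEnd` are `Prop`s that enter the theorems as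
BINDERS; NOTHING is asserted about them, and nothing here says any of them, (c4a-E), the crux, №4, HC_AV, HC_CM or HC holds; HC_CM HELD, by name only;
typed ≠ proved. No `sorry`, no stub, no named fact. [cite: Markman2025SecantWeil, §9.3 Lemma 9.3.5, Lemma 9.3.11] [cite: Mukai1978, §3]
[cite: MumfordAV1970, §7 Thm. 4 (p. 72), §12 Thm. 1 (p. 111)]
-/

noncomputable section

open CategoryTheory CategoryTheory.Category CategoryTheory.Limits AlgebraicGeometry Topology
open DerivedCategory

namespace Summit.HodgeConjecture.HodgeConjecture.Ring2.SemiregularRepresentatives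

set_option linter.dupNamespace false -- the cell's namespace repeats the summit name, as in every `Ring2*` file

namespace NowhereDisplaceable

open Literature.AlgebraicGeometry Literature.AlgebraicGeometry.Motives Literature.AlgebraicGeometry.Motives.AbelianVariety
open Literature.AlgebraicGeometry.HodgeTheory Literature.AlgebraicGeometry.Markman2025
open Literature.AlgebraicGeometry.KTheory Literature.AlgebraicGeometry.Modules
open Literature.AlgebraicTopology.SingularHomology
open Summit.HodgeConjecture.HodgeConjecture.Ring2.SemiregularRepresentatives.MoverTrap
/-! ## §1 The statements -/

/-- **(N-U) as a `Prop`** — the negation line's registered stub `stub_upstairsProperJumpCarrierExists_End` VERBATIM (workfile v2 l.270): at every End-trivial,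
OFF-hyperelliptic, orbit-disjoint datum some pinned-served class carries a pinned twisted datum whose PULLED-BACK complex `q^* 𝓓.E` on `P = J × Ĵ` has its
Ext-jump locus inside `{1} ∪ V(ℂ)` for a proper closed `V ⊊ J × Ĵ`. [cite: Markman2025SecantWeil, §9.3 Lemma 9.3.11] [cite: Mukai1978, §3] -/
@[conjecture] def UpstairsProperJumpCarrierEnd : Prop :=
  ∀ (C : ChernCharacterBetti) (D : SecantQuotientDatum) (θ₀ : complexBetti D.𝒥.J.X 2),
    ¬ D.𝒥.IsHyperelliptic → OrbitTranslatesDisjoint D.𝒥 D.G₁ D.G₂ → D.𝒥.J.IsPolarizationClassOf D.Θ θ₀ → EndTrivial D →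
    ∃ γ ∈ secantQuotientServedClassesPinned D.Y.X (D.hY θ₀), ∃ 𝓓 : PinnedTwistedDatum C AdmTw' D.Y.X (D.hY θ₀) γ,
      ProperJump D.P (quotientPullbackComplex D 𝓓.E)

/-- **(N-F) as a `Prop`** — the negation line's registered stub `stub_extJumpLocus_lifts` VERBATIM (workfile v2 l.239): for EVERY bounded vector-bundle complex
`E•` on `Y`, a jump of `E•` at `q(p)` is a jump of `q^*E•` at `p`. [cite: Mukai1978, §3] [cite: StacksProject, Tag 0BVH and Tag 0DVC] -/
@[conjecture] def ExtJumpLocusLifts : Prop :=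
  ∀ (D : SecantQuotientDatum) (E : CochainComplex D.Y.X.left.Modules ℤ), IsBoundedVBComplex E →
    ∀ p : D.P.Points ℂ, AlgPoints.map D.q.hom.hom.hom p ∈ extJumpLocus D.Y E → p ∈ extJumpLocus D.P (quotientPullbackComplex D E)

/-- **The lift clause AT ONE COMPLEX** `E•` on `Y = D.Y.X`: jumps of `E•` lift along `q` to jumps of `q^*E•` (the pointwise instance of (N-F) the composition
`properJumpCarrierExists_End_of_line` actually consumes, namely at `E• := 𝓓.E`). [cite: Mukai1978, §3] [cite: MumfordAV1970, §7 Thm. 4 (p. 72)] -/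
def JumpsLiftAt (D : SecantQuotientDatum) (E : CochainComplex D.Y.X.left.Modules ℤ) : Prop :=
  ∀ p : D.P.Points ℂ, AlgPoints.map D.q.hom.hom.hom p ∈ extJumpLocus D.Y E → p ∈ extJumpLocus D.P (quotientPullbackComplex D E)

/-- **(N-U⁺) THE LIFTED CARRIER** — (N-U)'s binders VERBATIM; conclusion `ProperJump (J × Ĵ) (q^* 𝓓.E) ∧ JumpsLiftAt D 𝓓.E`: the witness datum's pulled-back
complex has proper upstairs jump locus AND its downstairs jumps lift. For a DESCENDED carrier (print's `Ē_a`, `q^*Ē_a ≅ E ⊗ det^{-a}` with its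
`K`-linearisation) the second conjunct is the equivariant-descent identity `Hom_{D(Y)} = (Hom_{D(P)})^K` (char 0), not the trace retract of an arbitrary complex.
[cite: Markman2025SecantWeil, §9.3 Lemma 9.3.11] [cite: MumfordAV1970, §7 Thm. 4 (p. 72) and §12 Thm. 1 (p. 111)] [cite: Mukai1978, §3] -/
@[conjecture] def UpstairsProperJumpLiftedCarrierEnd : Prop :=
  ∀ (C : ChernCharacterBetti) (D : SecantQuotientDatum) (θ₀ : complexBetti D.𝒥.J.X 2),
    ¬ D.𝒥.IsHyperelliptic → OrbitTranslatesDisjoint D.𝒥 D.G₁ D.G₂ → D.𝒥.J.IsPolarizationClassOf D.Θ θ₀ → EndTrivial D →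
    ∃ γ ∈ secantQuotientServedClassesPinned D.Y.X (D.hY θ₀), ∃ 𝓓 : PinnedTwistedDatum C AdmTw' D.Y.X (D.hY θ₀) γ,
      ProperJump D.P (quotientPullbackComplex D 𝓓.E) ∧ JumpsLiftAt D 𝓓.E

/-- **(S4) as a `Prop`** — birth v3.18 l.479–486 ∕ the conclusion of p674094's `properJumpCarrierExists_End_of_line` VERBATIM (the T3 designate
`stub_properJumpCarrierExists_End`): a pinned-served class carries a pinned twisted datum whose complex on `Y` has PROPER Ext-jump locus.
[cite: Markman2025SecantWeil, §9.3 Lemma 9.3.11] -/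
@[conjecture] def ProperJumpCarrierEnd : Prop :=
  ∀ (C : ChernCharacterBetti) (D : SecantQuotientDatum) (θ₀ : complexBetti D.𝒥.J.X 2),
    ¬ D.𝒥.IsHyperelliptic → OrbitTranslatesDisjoint D.𝒥 D.G₁ D.G₂ → D.𝒥.J.IsPolarizationClassOf D.Θ θ₀ → EndTrivial D →
    ∃ γ ∈ secantQuotientServedClassesPinned D.Y.X (D.hY θ₀), ∃ 𝓓 : PinnedTwistedDatum C AdmTw' D.Y.X (D.hY θ₀) γ,
      ∃ (V : SchemeOver ℂ) (ι : V ⟶ D.Y.X), IsClosedImmersion ι.left ∧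
        Set.range (AlgPoints.map (L := ℂ) ι) ≠ Set.univ ∧
        extJumpLocus D.Y 𝓓.E ⊆ {1} ∪ Set.range (AlgPoints.map (L := ℂ) ι)

/-- **(R) as a `Prop`** — the binder of p674291's `extJumpLocus_lifts_of_retract` VERBATIM: every bounded vector-bundle complex `E•` on `Y` is a retract of
`q_*q^*E•` (the trace ∕ Maschke splitting of the unit; core-w5's `PullbackPushforwardRetract` programme). [cite: Mukai1978, §3] [cite: Lipman2009, Prop. 3.2.3] -/
@[conjecture] def PushPullRetract : Prop :=
  ∀ (D : SecantQuotientDatum) (E : CochainComplex D.Y.X.left.Modules ℤ), IsBoundedVBComplex E →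
    ∃ (i : E ⟶ ((Scheme.Modules.pushforward (Hom.toSchemeHom D.q)).mapHomologicalComplex (ComplexShape.up ℤ)).obj (quotientPullbackComplex D E))
      (r : ((Scheme.Modules.pushforward (Hom.toSchemeHom D.q)).mapHomologicalComplex (ComplexShape.up ℤ)).obj (quotientPullbackComplex D E) ⟶ E),
      i ≫ r = 𝟙 E

/-- **(R)_E — RETRACT AT ONE COMPLEX**: `E•` is a retract of `q_*q^*E•` (the pointwise instance of (R)). For a DESCENDED carrier `Ē = (q_*F)^K` (print's
`Ē_a`, `F = E ⊗ det^{-a}` with its `K`-linearisation, `q^*Ē ≅ F`) this is the REYNOLDS PROJECTOR `(1/|K|) Σ_{g ∈ K} g` on `q_*F` (an `𝒪_Y`-linear idempotent,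
char 0) — NOT the trace of an arbitrary finite locally free algebra, which is what (R) for every `E•` needs.
[cite: MumfordAV1970, §7 Thm. 4 (p. 72) and §12 Thm. 1 (p. 111)] [cite: Mukai1978, §3] -/
def RetractAt (D : SecantQuotientDatum) (E : CochainComplex D.Y.X.left.Modules ℤ) : Prop :=
  ∃ (i : E ⟶ ((Scheme.Modules.pushforward (Hom.toSchemeHom D.q)).mapHomologicalComplex (ComplexShape.up ℤ)).obj (quotientPullbackComplex D E))
    (r : ((Scheme.Modules.pushforward (Hom.toSchemeHom D.q)).mapHomologicalComplex (ComplexShape.up ℤ)).obj (quotientPullbackComplex D E) ⟶ E),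
    i ≫ r = 𝟙 E

/-- **(N-U_R) THE RETRACT CARRIER** — (N-U)'s binders VERBATIM; conclusion `ProperJump (J × Ĵ) (q^* 𝓓.E) ∧ RetractAt D 𝓓.E`: the form in which a closer of (N-U)
following print's descent construction delivers the lift clause (Reynolds projector on `q_*(E ⊗ det^{-a})`). [cite: Markman2025SecantWeil, §9.3 Lemma 9.3.11]
[cite: MumfordAV1970, §7 Thm. 4 (p. 72)] -/
@[conjecture] def UpstairsProperJumpRetractCarrierEnd : Prop :=
  ∀ (C : ChernCharacterBetti) (D : SecantQuotientDatum) (θ₀ : complexBetti D.𝒥.J.X 2),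
    ¬ D.𝒥.IsHyperelliptic → OrbitTranslatesDisjoint D.𝒥 D.G₁ D.G₂ → D.𝒥.J.IsPolarizationClassOf D.Θ θ₀ → EndTrivial D →
    ∃ γ ∈ secantQuotientServedClassesPinned D.Y.X (D.hY θ₀), ∃ 𝓓 : PinnedTwistedDatum C AdmTw' D.Y.X (D.hY θ₀) γ,
      ProperJump D.P (quotientPullbackComplex D 𝓓.E) ∧ RetractAt D 𝓓.E

/-- **(N-U⁺ᶠ) THE FACTOR-CONFINED LIFTED CARRIER** — g3's (U-fac) `FactorJumpIsogeny.FactorConfinedCarrierEnd` (an isogeny `Λ` of `J × Ĵ` maps the upstairs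
jump locus into a proper closed `W`) with the lift clause added; print's shape is `Λ = Λ₂ = (φ ∘ pr₁, pr₂)`, `W = J₂ ∪ (J × {𝒪})`-type loci.
[cite: Markman2025SecantWeil, §9.3 Lemma 9.3.11] [cite: MumfordAV1970, §7 Thm. 4 (p. 72)] -/
@[conjecture] def FactorConfinedLiftedCarrierEnd : Prop :=
  ∀ (C : ChernCharacterBetti) (D : SecantQuotientDatum) (θ₀ : complexBetti D.𝒥.J.X 2),
    ¬ D.𝒥.IsHyperelliptic → OrbitTranslatesDisjoint D.𝒥 D.G₁ D.G₂ → D.𝒥.J.IsPolarizationClassOf D.Θ θ₀ → EndTrivial D →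
    ∃ γ ∈ secantQuotientServedClassesPinned D.Y.X (D.hY θ₀), ∃ 𝓓 : PinnedTwistedDatum C AdmTw' D.Y.X (D.hY θ₀) γ,
      (∃ (Λ : D.P ⟶ D.P), IsIsogeny Λ ∧ ∃ (W : SchemeOver ℂ) (κ : W ⟶ D.P.X), IsClosedImmersion κ.left ∧
        Set.range (AlgPoints.map (L := ℂ) κ) ≠ Set.univ ∧
        ∀ p ∈ extJumpLocus D.P (quotientPullbackComplex D 𝓓.E), AlgPoints.map Λ.hom.hom.hom p ∈ Set.range (AlgPoints.map (L := ℂ) κ)) ∧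
      JumpsLiftAt D 𝓓.E

/-! ## §2 Logic (sorry-free, over landed bricks only) -/

/-- `(N-U⁺) → (N-U)`: forget the lift clause. -/
theorem upstairs_of_lifted (h : UpstairsProperJumpLiftedCarrierEnd) : UpstairsProperJumpCarrierEnd := by
  intro C D θ₀ hnh hH hθ₀ hEnd
  obtain ⟨γ, hγ, 𝓓, hP, -⟩ := h C D θ₀ hnh hH hθ₀ hEnd
  exact ⟨γ, hγ, 𝓓, hP⟩

/-- `(N-F) → (N-U) → (N-U⁺)`: the universally quantified lift gives the lift clause at the witness. -/
theorem lifted_of_upstairs_of_lifts (hF : ExtJumpLocusLifts) (hU : UpstairsProperJumpCarrierEnd) : UpstairsProperJumpLiftedCarrierEnd := by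
  intro C D θ₀ hnh hH hθ₀ hEnd
  obtain ⟨γ, hγ, 𝓓, hP⟩ := hU C D θ₀ hnh hH hθ₀ hEnd
  exact ⟨γ, hγ, 𝓓, hP, hF D 𝓓.E 𝓓.bounded⟩

/-- `(R) → (N-U) → (N-U⁺)` — the OPTIONAL upgrade path: p674291's `extJumpLocus_lifts_of_retract : (R) → (N-F)` BY NAME. [cite: Mukai1978, §3] -/
theorem lifted_of_upstairs_of_retract (hret : PushPullRetract) (hU : UpstairsProperJumpCarrierEnd) : UpstairsProperJumpLiftedCarrierEnd :=
  lifted_of_upstairs_of_lifts (extJumpLocus_lifts_of_retract hret) hU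

/-- **(R)_E → LIFT AT `E•`** — p674291's `extJumpLocus_lifts_of_retract` LOCALISED at one complex (its proof transcribed: it consumes the retract only at
`(D, E•)`): a non-zero `φ : τ_{q p}^*E• → E•[k]` stays non-zero after `≫ i` (retract), crosses the derived adjunction along the affine `q` (p674291's
`shiftedHomLinearEquivPullbackPushforwardOfVectorBundles`) and the iso `q^*τ_{q p}^* ≅ τ_p^*q^*`. [cite: Mukai1978, §3] [cite: StacksProject, Tag 0BVH and Tag 0DVC]
[cite: Lipman2009, Prop. 3.2.3] -/
theorem jumpsLiftAt_of_retractAt (D : SecantQuotientDatum) (E : CochainComplex D.Y.X.left.Modules ℤ) (hE : IsBoundedVBComplex E)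
    (hret : RetractAt D E) : JumpsLiftAt D E := by
  intro p hp
  letI := HasDerivedCategory.standard D.Y.X.left.Modules
  letI := HasDerivedCategory.standard D.P.X.left.Modules
  obtain ⟨k, hk⟩ := hp
  refine ⟨k, ?_⟩
  -- a non-zero class downstairs
  rw [not_subsingleton_iff_nontrivial] at hk
  obtain ⟨φ, hφ⟩ := exists_ne (0 : ShiftedHom (Q.obj (translationPullbackComplex D.Y (AlgPoints.map D.q.hom.hom.hom p) E)) (Q.obj E) k)
  -- push it into `q_*q^*E` along the retract AT `E`
  obtain ⟨i, r, hir⟩ := hret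
  set ψ : ShiftedHom (Q.obj (translationPullbackComplex D.Y (AlgPoints.map D.q.hom.hom.hom p) E))
      (Q.obj (((Scheme.Modules.pushforward (Hom.toSchemeHom D.q)).mapHomologicalComplex (ComplexShape.up ℤ)).obj (quotientPullbackComplex D E))) k :=
    φ ≫ (Q.map i)⟦k⟧' with hψdef
  have hψ : ψ ≠ 0 := by
    intro h0
    apply hφ
    have hback : ψ ≫ (Q.map r)⟦k⟧' = φ := by
      rw [hψdef, assoc, ← Functor.map_comp, ← Functor.map_comp, hir, CategoryTheory.Functor.map_id, CategoryTheory.Functor.map_id, comp_id]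
    rw [← hback, h0, zero_comp]
  -- the derived adjunction along the affine `q`
  haveI : IsFinite (Hom.toSchemeHom D.q) := D.isIsogeny_q.2
  haveI : (Scheme.Modules.pushforward (Hom.toSchemeHom D.q)).Linear ℂ := linear_pushforward D.q.hom.hom.hom
  have hM : IsBoundedVBComplex (translationPullbackComplex D.Y (AlgPoints.map D.q.hom.hom.hom p) E) := hE.pullback _
  have hL : IsBoundedVBComplex (quotientPullbackComplex D E) := hE.pullback _
  obtain ⟨a₀, b₀, hMa, hMb⟩ := IsBoundedVBComplex.exists_bounds hM
  obtain ⟨a, _, hLa, _⟩ := IsBoundedVBComplex.exists_bounds hL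
  let Ψ := shiftedHomLinearEquivPullbackPushforwardOfVectorBundles (𝕜 := ℂ) (Hom.toSchemeHom D.q)
    (translationPullbackComplex D.Y (AlgPoints.map D.q.hom.hom.hom p) E) a₀ b₀ hMa hMb hM.isFiniteLocallyFree
    (quotientPullbackComplex D E) a hLa hL.isFiniteLocallyFree k
  have hχ : Ψ.symm ψ ≠ 0 := by
    intro h0
    apply hψ
    have := congrArg Ψ h0
    rwa [LinearEquiv.apply_symm_apply, map_zero] at this
  -- transport along `τ_p^* q^* ≅ q^* τ_{q p}^*`
  obtain ⟨e⟩ := nonempty_quotientPullback_translationPullback_iso D p E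
  intro hsub
  apply hχ
  have hzero : Q.map e.inv ≫ Ψ.symm ψ = 0 := Subsingleton.elim _ _
  calc Ψ.symm ψ = Q.map e.hom ≫ Q.map e.inv ≫ Ψ.symm ψ := by
        rw [← assoc, ← Functor.map_comp, Iso.hom_inv_id, CategoryTheory.Functor.map_id, id_comp]
    _ = 0 := by rw [hzero, comp_zero]

/-- (R) gives (R)_E everywhere (for the record). -/
theorem retractAt_of_pushPullRetract (hret : PushPullRetract) (D : SecantQuotientDatum) (E : CochainComplex D.Y.X.left.Modules ℤ)
    (hE : IsBoundedVBComplex E) : RetractAt D E :=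
  hret D E hE

/-- **`(N-U_R) → (N-U⁺)`**: the retract at the witness gives the lift clause at the witness (`jumpsLiftAt_of_retractAt` with `𝓓.bounded`). -/
theorem lifted_of_retractCarrier (h : UpstairsProperJumpRetractCarrierEnd) : UpstairsProperJumpLiftedCarrierEnd := by
  intro C D θ₀ hnh hH hθ₀ hEnd
  obtain ⟨γ, hγ, 𝓓, hP, hret⟩ := h C D θ₀ hnh hH hθ₀ hEnd
  exact ⟨γ, hγ, 𝓓, hP, jumpsLiftAt_of_retractAt D 𝓓.E 𝓓.bounded hret⟩

/-- **`(N-U⁺) → (S4)` WITH NO FURTHER INPUT** — jump descent for the witness complex: the LANDED (N-I) `properJump_of_confinedLifts` (p673373) fed by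
`confinedLifts_of_lifts_of_upstairs` (p674094) at `E• := 𝓓.E`. [cite: MumfordAV1970, §7 Thm. 4 (p. 72)] [cite: Markman2025SecantWeil, §9.3 Lemma 9.3.11] -/
theorem properJumpCarrierEnd_of_lifted (h : UpstairsProperJumpLiftedCarrierEnd) : ProperJumpCarrierEnd := by
  intro C D θ₀ hnh hH hθ₀ hEnd
  obtain ⟨γ, hγ, 𝓓, ⟨V, ι, hι, hV, hconf⟩, hlift⟩ := h C D θ₀ hnh hH hθ₀ hEnd
  exact ⟨γ, hγ, 𝓓, properJump_of_confinedLifts D 𝓓.E V ι hι hV (confinedLifts_of_lifts_of_upstairs hlift hconf)⟩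

/-- `(N-U⁺ᶠ) → (N-U⁺)`: the preimage of the proper closed `W` under the isogeny `Λ` is proper closed — the LANDED (U-pre) `preimage_properClosed_of_isIsogeny`
(p674495) BY NAME. [cite: MumfordAV1970, §7 Thm. 4 (p. 72)] -/
theorem lifted_of_factorConfinedLifted (h : FactorConfinedLiftedCarrierEnd) : UpstairsProperJumpLiftedCarrierEnd := by
  intro C D θ₀ hnh hH hθ₀ hEnd
  obtain ⟨γ, hγ, 𝓓, ⟨Λ, hΛ, W, κ, hκ, hW, hconf⟩, hlift⟩ := h C D θ₀ hnh hH hθ₀ hEnd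
  obtain ⟨V, ι, hι, hV, hpre⟩ := preimage_properClosed_of_isIsogeny D Λ hΛ W κ hκ hW
  exact ⟨γ, hγ, 𝓓, ⟨V, ι, hι, hV, fun p hp => Set.mem_union_right _ (hpre p (hconf p hp))⟩, hlift⟩

/-- **(c4a-E) FROM THE LIFTED CARRIER** — `Raynaud1983_maninMumford → (N-U⁺) → ∀ C, PrintSheafHandleExistsEnd C` through p664145's
`printSheafHandleExistsEnd_of_stubs` with the LANDED S2 `MoverTrap.moverConfinement_of_KSimple` (p667380) and S3 `MoverTrap.kSimple_of_endTrivial` (p665569)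
BY NAME and THIS file's `properJumpCarrierEnd_of_lifted`. [cite: Raynaud1983SousVarietes, Théorème principal (p. 327)] [cite: Markman2025SecantWeil, §9.3 Lemma 9.3.11] -/
theorem printSheafHandleExistsEnd_of_lifted (hR : Raynaud1983_maninMumford) (h : UpstairsProperJumpLiftedCarrierEnd) :
    ∀ C : ChernCharacterBetti, PrintSheafHandleExistsEnd C :=
  printSheafHandleExistsEnd_of_stubs hR moverConfinement_of_KSimple kSimple_of_endTrivial (properJumpCarrierEnd_of_lifted h)

/-- (c4a-E) from (S4) alone, for the record (the same composition with (S4) displayed). [cite: Raynaud1983SousVarietes, Théorème principal (p. 327)] -/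
theorem printSheafHandleExistsEnd_of_properJumpCarrierEnd (hR : Raynaud1983_maninMumford) (h : ProperJumpCarrierEnd) :
    ∀ C : ChernCharacterBetti, PrintSheafHandleExistsEnd C :=
  printSheafHandleExistsEnd_of_stubs hR moverConfinement_of_KSimple kSimple_of_endTrivial h

#print axioms upstairs_of_lifted
#print axioms lifted_of_upstairs_of_lifts
#print axioms lifted_of_upstairs_of_retract
#print axioms jumpsLiftAt_of_retractAt
#print axioms retractAt_of_pushPullRetract
#print axioms lifted_of_retractCarrier
#print axioms properJumpCarrierEnd_of_lifted
#print axioms lifted_of_factorConfinedLifted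
#print axioms printSheafHandleExistsEnd_of_lifted
#print axioms printSheafHandleExistsEnd_of_properJumpCarrierEnd

end NowhereDisplaceable

end Summit.HodgeConjecture.HodgeConjecture.Ring2.SemiregularRepresentatives
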